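import Summits.KontsevichZagierPeriods.Zeta5Search.Certificates.TwoTaleTelescopeALFin

/-!
# (bmiss)@Ω — cert-2's certificate atoms of direction `a`, side `L`, evaluated (cell `pub-zeta5`, cert-1 gen 4)

HONEST FRAMING: systematic search; recurrence certificates; no irrationality claim unless certified. Pure algebra over `ℚ`.

Values of the opaque atoms of `Certificates.TwoTaleTelescope.telescope_a_L` (variable `t`): the Γ-ratio linear-form products
`lprod numALk/denALk/tnAL/tdAL/cnumAL/cnumSAL/cdenAL/cdenSAL`, and the cubic certificate numerator `x_L` as a polynomial `xPolyAL`
(`eval_xPolyAL : (xPolyAL …).eval (t+s) = polyTN xAL s … t`). Mirror of `CertAtomsE` (side `L` part).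
-/

noncomputable section

open Polynomial
open Summit.KontsevichZagierPeriods.Zeta5Search.Certificates.TwoTaleTelescope

namespace Summit.KontsevichZagierPeriods.Zeta5Search.TwoTaleOmega

/-- Value of cert-2's atom `lprod numAL1`. -/
theorem numAL1_eval (a b e f g t : ℚ) : lprod numAL1 a b e f g t = (a + t) := by
  simp only [lprod_cons, lprod_nil, lval, numAL1, List.getD_cons_zero, List.getD_cons_succ]
  push_cast; ring

/-- Value of cert-2's atom `lprod numAL2`. -/
theorem numAL2_eval (a b e f g t : ℚ) : lprod numAL2 a b e f g t = (a + t) * (a + t + 1) := by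
  simp only [lprod_cons, lprod_nil, lval, numAL2, List.getD_cons_zero, List.getD_cons_succ]
  push_cast; ring

/-- Value of cert-2's atom `lprod numAL3`. -/
theorem numAL3_eval (a b e f g t : ℚ) : lprod numAL3 a b e f g t = (a + t) * (a + t + 1) * (a + t + 2) := by
  simp only [lprod_cons, lprod_nil, lval, numAL3, List.getD_cons_zero, List.getD_cons_succ]
  push_cast; ring

/-- Value of cert-2's atom `lprod denAL1`. -/
theorem denAL1_eval (a b e f g t : ℚ) : lprod denAL1 a b e f g t = (a - e + t + 1) * (a - f + t + 1) := by
  simp only [lprod_cons, lprod_nil, lval, denAL1, List.getD_cons_zero, List.getD_cons_succ]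
  push_cast; ring

/-- Value of cert-2's atom `lprod denAL2`. -/
theorem denAL2_eval (a b e f g t : ℚ) : lprod denAL2 a b e f g t = (a - e + t + 1) * (a - e + t + 2) * (a - f + t + 1) * (a - f + t + 2) := by
  simp only [lprod_cons, lprod_nil, lval, denAL2, List.getD_cons_zero, List.getD_cons_succ]
  push_cast; ring

/-- Value of cert-2's atom `lprod denAL3`. -/
theorem denAL3_eval (a b e f g t : ℚ) : lprod denAL3 a b e f g t = (a - e + t + 1) * (a - e + t + 2) * (a - e + t + 3) * (a - f + t + 1) * (a - f + t + 2) * (a - f + t + 3) := by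
  simp only [lprod_cons, lprod_nil, lval, denAL3, List.getD_cons_zero, List.getD_cons_succ]
  push_cast; ring

/-- Value of cert-2's atom `lprod tnAL`. -/
theorem tnAL_eval (a b e f g t : ℚ) : lprod tnAL a b e f g t = (a + t) * (b + t) * (e + t) * (f + t) := by
  simp only [lprod_cons, lprod_nil, lval, tnAL, List.getD_cons_zero, List.getD_cons_succ]
  push_cast; ring

/-- Value of cert-2's atom `lprod tdAL`. -/
theorem tdAL_eval (a b e f g t : ℚ) : lprod tdAL a b e f g t = (t + 1) * (a - e + t + 1) * (a - f + t + 1) * (g + t) := by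
  simp only [lprod_cons, lprod_nil, lval, tdAL, List.getD_cons_zero, List.getD_cons_succ]
  push_cast; ring

/-- Value of cert-2's atom `lprod cnumAL`. -/
theorem cnumAL_eval (a b e f g t : ℚ) : lprod cnumAL a b e f g t = (t) * (g + t - 1) * (a - e + t + 3) * (a - f + t + 3) := by
  simp only [lprod_cons, lprod_nil, lval, cnumAL, List.getD_cons_zero, List.getD_cons_succ]
  push_cast; ring

/-- Value of cert-2's atom `lprod cnumSAL`. -/
theorem cnumSAL_eval (a b e f g t : ℚ) : lprod cnumSAL a b e f g t = (t + 1) * (g + t) * (a - e + t + 4) * (a - f + t + 4) := by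
  simp only [lprod_cons, lprod_nil, lval, cnumSAL, List.getD_cons_zero, List.getD_cons_succ]
  push_cast; ring

/-- Value of cert-2's atom `lprod cdenAL`. -/
theorem cdenAL_eval (a b e f g t : ℚ) : lprod cdenAL a b e f g t = (a - e + t + 1) * (a - f + t + 1) * (a - e + t + 2) * (a - f + t + 2) * (a - e + t + 3) * (a - f + t + 3) := by
  simp only [lprod_cons, lprod_nil, lval, cdenAL, List.getD_cons_zero, List.getD_cons_succ]
  push_cast; ring

/-- Value of cert-2's atom `lprod cdenSAL`. -/
theorem cdenSAL_eval (a b e f g t : ℚ) : lprod cdenSAL a b e f g t = (a - e + t + 2) * (a - f + t + 2) * (a - e + t + 3) * (a - f + t + 3) * (a - e + t + 4) * (a - f + t + 4) := by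
  simp only [lprod_cons, lprod_nil, lval, cdenSAL, List.getD_cons_zero, List.getD_cons_succ]
  push_cast; ring

/-- The `j`-th coefficient `x_j(a,b,e,f,g)` of the side-`L` certificate numerator of direction `a`. -/
def xALc (j : ℕ) (a b e f g : ℚ) : ℚ := spvalC (xAL.getD j []) a b e f g

/-- The side-`L` certificate numerator of direction `a` as a polynomial in `t`: `x_L = x₀ + x₁X + x₂X² + x₃X³`. -/
def xPolyAL (a b e f g : ℚ) : ℚ[X] :=
  C (xALc 0 a b e f g) + C (xALc 1 a b e f g) * X + C (xALc 2 a b e f g) * X ^ 2 + C (xALc 3 a b e f g) * X ^ 3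

/-- `x_L` evaluated at `t + s` is cert-2's atom `polyTN xAL s`. -/
theorem eval_xPolyAL (s : ℤ) (a b e f g t : ℚ) : (xPolyAL a b e f g).eval (t + s) = polyTN xAL s a b e f g t := by
  have hl : xAL.length = 4 := rfl
  simp only [polyTN, hl, xPolyAL, xALc, eval_add, eval_mul, eval_C, eval_X, eval_pow]
  simp [List.range_succ]
  ring

/-- `deg x_L ≤ 3`. -/
theorem natDegree_xPolyAL_le (a b e f g : ℚ) : (xPolyAL a b e f g).natDegree ≤ 3 := by
  unfold xPolyAL
  refine (natDegree_add_le _ _).trans (max_le ((natDegree_add_le _ _).trans (max_le ((natDegree_add_le _ _).trans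
    (max_le ?_ ?_)) ?_)) ?_)
  · exact (natDegree_C _).le.trans (by norm_num)
  · exact (natDegree_C_mul_le _ _).trans (natDegree_X_le.trans (by norm_num))
  · exact (natDegree_C_mul_le _ _).trans ((natDegree_pow_le).trans (by simp))
  · exact (natDegree_C_mul_le _ _).trans ((natDegree_pow_le).trans (by simp))

end Summit.KontsevichZagierPeriods.Zeta5Search.TwoTaleOmega

end
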